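import Summits.ABC.ABC.Theses.IsogenyGlueCongruence
import Summits.ABC.ABC.Theorems.DefiniteXiFreyModularityIsModular
import Literature.NumberTheory.Automorphic.BCDTModularity
import Literature.NumberTheory.EllipticCurves.ModularParametrizationTrustBaseProofs
import Literature.NumberTheory.EllipticCurves.ModularParametrizationDegreeHoldsProofs
import Literature.NumberTheory.DiophantineGeometry.PastenValuationProductsProofs
import HarnessLib

/-!
# Route IsogenyGlueCongruence, item `ModularDatumExists` (stmt-ABC-15126): the item is exactly
# the Modularity Theorem in the form (2) of BCDT

Item stmt-ABC-15126 of route `IsogenyGlueCongruence` asks for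

  `∀ (W : WeierstrassCurve ℚ) [W.IsElliptic] [W.IsGloballyMinimal] [NeZero (W.conductorNorm ℤ)],
     Nonempty (ModularParametrizationData W (W.conductorNorm ℤ))`

— every elliptic curve over `ℚ`, in a globally minimal model `W` of conductor `N_W`, carries a
modular parametrisation datum at level `N_W` (its newform `f`, a Néron lattice, the uniformisation
`ℂ →+ E(ℂ)`, an integer Manin constant `c` with `c Λ_f ⊆ Λ_E`, the modular degree). This is,
character for character, the body of the named fact
`Literature.NumberTheory.EllipticCurves.ModularForms.nonempty_modularParametrizationData`
(Breuil–Conrad–Diamond–Taylor 2001, Thm. A in the analytic form (6) of p. 845).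

The tree already knows (`ModularParametrizationTrustBaseProofs`) that this fact is *exactly* the
conjunction of Modularity in the form (2), `exists_isNewformOf` (BCDT Thm. A: a newform
`f ∈ S₂(Γ₀(N_E))` with `aₙ(f) = aₙ(E)`), and the commensurability statement
`IsNewformOf.exists_maninConstant_ne_zero` ("(2) ⇒ (6)": Shimura's construction and Faltings'
isogeny theorem) — and the latter is now a THEOREM of the tree
(`IsNewformOf.exists_maninConstant_ne_zero_holds`, `ModularParametrizationDegreeHoldsProofs`).
This file cashes that in for the item, concluding in the route decl
`Summit.ABC.ABC.Theses.IsogenyGlueCongruence.ModularDatumExists` BY NAME (rev 11 of the route file;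
the decl is definitionally the named fact, `modularDatumExists_iff_nonempty_modularParametrizationData`):

* `modularDatumExists_iff_exists_isNewformOf` — **unconditionally, the item is equivalent to
  `exists_isNewformOf`** (BCDT Thm. A, the programme's modularity apex); nothing else is left.
* `modularDatumExists_iff_forall_isModular` — the same with (2) spelled `BCDT.IsModular W` for
  every elliptic `W/ℚ`.
* `modularDatumExists_of_exists_isNewformOf` — the one-hypothesis closed form (closes the item by
  `exact modularDatumExists_of_exists_isNewformOf exists_isNewformOf_holds` the day Thm. A is
  discharged); `modularDatumExists_of_theoremB_of_CDT` — the same from the printed decomposition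
  Thm. A = Thm. B + [CDT, Thm. 7.2.4] (`BCDT.exists_isNewformOf_of_theoremB_of_CDT`).
* `nonempty_modularParametrizationData_iff_isModular` — **per curve, unconditionally**: an
  elliptic `W/ℚ` admits a datum at level `N_W` iff `BCDT.IsModular W`.
* `nonempty_modularParametrizationData_of_isSemistable_of_CDT_theorem_7_1_2` — **the semistable
  slice** (all that the K-line consumer `DegreePrimeCongruence` uses) from the smaller named fact
  `BCDT.CDT_theorem_7_1_2` (Conrad–Diamond–Taylor 1999, Thm. 7.1.2: conductor not divisible by
  `27` ⟹ modular; contains Wiles 1995 Thm. 0.4 / Taylor–Wiles for semistable curves): a semistable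
  curve has squarefree conductor (`WeierstrassCurve.isSemistable_iff_squarefree_conductorNorm`),
  so `27 ∤ N_W`.

Trust base of the item after this file: `exists_isNewformOf` alone (semistable slice:
`BCDT.CDT_theorem_7_1_2`).

## References

* C. Breuil, B. Conrad, F. Diamond, R. Taylor, *On the modularity of elliptic curves over `ℚ`:
  wild 3-adic exercises*, J. Amer. Math. Soc. 14 (2001), 843–939: Thm. A; p. 845, (2) and (6);
  Thm. 2.2.2 (§2.2). [BCDTJAMS2001]
* B. Conrad, F. Diamond, R. Taylor, *Modularity of certain potentially Barsotti–Tate Galois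
  representations*, J. Amer. Math. Soc. 12 (1999), 521–567: Thm. 7.1.2, Thm. 7.2.4.
  [ConradDiamondTaylor1999]
* A. Wiles, *Modular elliptic curves and Fermat's Last Theorem*, Ann. of Math. 141 (1995): Thm. 0.4.
  [Wiles1995]
* F. Diamond, J. Shurman, *A first course in modular forms*, GTM 228 (2005): Thm. 8.8.3.
  [DiamondShurman2005]
-/

-- `Summit.<Summit>.<Problem>` is the mandated summit-side namespace (CONVENTIONS §2); for the
-- single-conjunct summit `ABC` the two coincide, so the duplicate `ABC.ABC` is deliberate.
set_option linter.dupNamespace false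

noncomputable section

open scoped MatrixGroups ModularForm

open CongruenceSubgroup
open Literature.NumberTheory.EllipticCurves
open Literature.NumberTheory.EllipticCurves.ModularForms
open Literature.NumberTheory.Automorphic

namespace Summit.ABC.ABC.Theorems

/-! ### The route decl is the named fact, definitionally -/

/-- **`ModularDatumExists` is verbatim the named fact `nonempty_modularParametrizationData`**
(Breuil–Conrad–Diamond–Taylor 2001, Thm. A in the analytic form (6) of p. 845, for globally minimal
models at the conductor level): the two `Prop`s have the same body, so the equivalence is `Iff.rfl`,
and the item closes by `exact nonempty_modularParametrizationData_holds` the day the fact is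
discharged. [cite: BCDTJAMS2001, Thm. A with (6) of p. 845] -/
theorem modularDatumExists_iff_nonempty_modularParametrizationData :
    Summit.ABC.ABC.Theses.IsogenyGlueCongruence.ModularDatumExists ↔
      nonempty_modularParametrizationData :=
  Iff.rfl

/-! ### The item is Modularity (2), unconditionally -/

/-- **`ModularDatumExists` ↔ `exists_isNewformOf`, unconditionally.** The item's signature (every
elliptic `W/ℚ` in a globally minimal model admits a `ModularParametrizationData` at level `N_W`;
verbatim the named fact `nonempty_modularParametrizationData`) is equivalent to the Modularity
Theorem in the form (2) of Breuil–Conrad–Diamond–Taylor 2001, p. 845 (`exists_isNewformOf`, their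
Thm. A: a newform `f ∈ S₂(Γ₀(N_E))` with `aₙ(f) = aₙ(E)` for all `n`). Proof: the tree's
`nonempty_modularParametrizationData_iff` (the fact is exactly (2) ∧ the rational Manin constant
`IsNewformOf.exists_maninConstant_ne_zero`) with the second conjunct discharged by
`IsNewformOf.exists_maninConstant_ne_zero_holds` (Shimura's construction `E_f = ℂ/Λ_f` with the
Eichler–Shimura congruence, and Faltings' isogeny theorem).
[cite: BCDTJAMS2001, Thm. A with p. 845, (2) ⇔ (6)] -/
theorem modularDatumExists_iff_exists_isNewformOf :
    Summit.ABC.ABC.Theses.IsogenyGlueCongruence.ModularDatumExists ↔ exists_isNewformOf :=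
  nonempty_modularParametrizationData_iff.trans
    (and_iff_left IsNewformOf.exists_maninConstant_ne_zero_holds)

/-- **`ModularDatumExists` ↔ every elliptic curve over `ℚ` is modular** (`BCDT.IsModular W`: a
newform of `W` in `S₂(Γ₀(N_W))`; Breuil–Conrad–Diamond–Taylor 2001, Introduction, condition (2)),
unconditionally: `modularDatumExists_iff_exists_isNewformOf` and `BCDT.exists_isNewformOf_iff`.
[cite: BCDTJAMS2001, Introduction, condition (2)] -/
theorem modularDatumExists_iff_forall_isModular :
    Summit.ABC.ABC.Theses.IsogenyGlueCongruence.ModularDatumExists ↔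
      ∀ (W : WeierstrassCurve ℚ) [W.IsElliptic] [NeZero (W.conductorNorm ℤ)], BCDT.IsModular W :=
  modularDatumExists_iff_exists_isNewformOf.trans BCDT.exists_isNewformOf_iff

/-! ### The closed forms modulo one named fact -/

/-- **`ModularDatumExists` from the Modularity Theorem alone** (Breuil–Conrad–Diamond–Taylor
2001, Thm. A = `exists_isNewformOf`): the `←` half of `modularDatumExists_iff_exists_isNewformOf`,
curried. This is the form in which item stmt-ABC-15126 closes the day `exists_isNewformOf` is
discharged. [cite: BCDTJAMS2001, Thm. A] -/
theorem modularDatumExists_of_exists_isNewformOf (hmod : exists_isNewformOf) :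
    Summit.ABC.ABC.Theses.IsogenyGlueCongruence.ModularDatumExists :=
  modularDatumExists_iff_exists_isNewformOf.mpr hmod

/-- **`ModularDatumExists` from Theorem B and CDT Thm. 7.2.4** — the printed proof of Theorem A
(Breuil–Conrad–Diamond–Taylor 2001, §2.2: Thm. 2.2.2 = Thm. 2.2.1 + [CDT, Thm. 7.2.4]) as assembled
in the tree (`BCDT.exists_isNewformOf_of_theoremB_of_CDT`, the Weil-pairing determinant being
proved), followed by `modularDatumExists_of_exists_isNewformOf`.
[cite: BCDTJAMS2001, Theorem 2.2.2] -/
theorem modularDatumExists_of_theoremB_of_CDT (hB : BCDT.theoremB) (hCDT : BCDT.CDT_theorem_7_2_4) :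
    Summit.ABC.ABC.Theses.IsogenyGlueCongruence.ModularDatumExists :=
  modularDatumExists_of_exists_isNewformOf (BCDT.exists_isNewformOf_of_theoremB_of_CDT hB hCDT)

/-! ### Per curve, and the semistable slice -/

/-- **Per curve, unconditionally: a datum at the conductor level is exactly modularity of that
curve.** For an elliptic `W/ℚ` (any model) with `N_W ≥ 1`:
`Nonempty (ModularParametrizationData W N_W) ↔ BCDT.IsModular W`. The level-`N` statement is the
tree's `nonempty_modularParametrizationData_iff_isModularAt` (`→` the datum's own newform; `←` a
Néron-type period pair, the rational Manin constant `IsNewformOf.exists_maninConstant_ne_zero_holds`,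
uniformisation and modular degree), read at `N = N_W`.
[cite: BCDTJAMS2001, p. 845, (2) ⇔ (6)] -/
theorem nonempty_modularParametrizationData_iff_isModular (W : WeierstrassCurve ℚ) [W.IsElliptic]
    [NeZero (W.conductorNorm ℤ)] :
    Nonempty (ModularParametrizationData W (W.conductorNorm ℤ)) ↔ BCDT.IsModular W :=
  nonempty_modularParametrizationData_iff_isModularAt W (W.conductorNorm ℤ)

/-- A squarefree natural number is not divisible by `27 = 3 · 3²`. [folklore] -/
theorem not_twentySeven_dvd_of_squarefree {n : ℕ} (hn : Squarefree n) : ¬ 27 ∣ n := fun h ↦ by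
  have h9 : 3 * 3 ∣ n := Nat.dvd_trans ⟨3, by norm_num⟩ h
  exact absurd (Nat.isUnit_iff.mp (hn 3 h9)) (by norm_num)

/-- **The semistable slice of `ModularDatumExists` from Conrad–Diamond–Taylor 1999, Thm. 7.1.2.**
If every elliptic curve over `ℚ` whose conductor is not divisible by `27` is modular
(`BCDT.CDT_theorem_7_1_2`; for semistable curves this is Wiles 1995, Thm. 0.4, with Taylor–Wiles),
then every SEMISTABLE elliptic `W/ℚ` (any model with `N_W ≥ 1`; in particular every globally
minimal one, the shape consumed by the K-line item `DegreePrimeCongruence`) admits a modular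
parametrisation datum at level `N_W`: a semistable curve has squarefree conductor
(`WeierstrassCurve.isSemistable_iff_squarefree_conductorNorm`, Ogg–Saito exponents `f_p ≤ 1`), so
`27 ∤ N_W`, `W` is modular, and `nonempty_modularParametrizationData_iff_isModular` gives the datum.
[cite: ConradDiamondTaylor1999, Thm. 7.1.2] -/
theorem nonempty_modularParametrizationData_of_isSemistable_of_CDT_theorem_7_1_2
    (h712 : BCDT.CDT_theorem_7_1_2) :
    ∀ (W : WeierstrassCurve ℚ) [W.IsElliptic] [NeZero (W.conductorNorm ℤ)], W.IsSemistable ℤ →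
      Nonempty (ModularParametrizationData W (W.conductorNorm ℤ)) := fun W _ _ hW ↦
  (nonempty_modularParametrizationData_iff_isModular W).mpr
    (h712 W (not_twentySeven_dvd_of_squarefree
      ((W.isSemistable_iff_squarefree_conductorNorm).mp hW)))

/-- **The semistable slice of `ModularDatumExists` from the Modularity Theorem** (`exists_isNewformOf`,
BCDT 2001 Thm. A; only its semistable case — Wiles 1995, Thm. 0.4 — is used), for any model with
`N_W ≥ 1` (no global minimality needed): `nonempty_modularParametrizationData_iff_isModular`.
[cite: Wiles1995, Thm. 0.4] -/
theorem nonempty_modularParametrizationData_of_isSemistable_of_exists_isNewformOf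
    (hmod : exists_isNewformOf) :
    ∀ (W : WeierstrassCurve ℚ) [W.IsElliptic] [NeZero (W.conductorNorm ℤ)], W.IsSemistable ℤ →
      Nonempty (ModularParametrizationData W (W.conductorNorm ℤ)) := fun W _ _ _ ↦
  (nonempty_modularParametrizationData_iff_isModular W).mpr (BCDT.exists_isNewformOf_iff.mp hmod W)

end Summit.ABC.ABC.Theorems

end
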